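import Mathlib
import Literature.Analysis.FluidPDE.SelfSimilarCollapseAnsatz
import Summits.NavierStokesRegularity.NavierStokesRegularity.Theorems.EulerZoomLiouvillePowerGaugeEulerLiouvilleSpiralPressureSlavingTop
import Summits.NavierStokesRegularity.NavierStokesRegularity.Theorems.EulerZoomLiouvillePowerGaugeEulerLiouvilleSelfSimilarPressureSlaving
import Summits.NavierStokesRegularity.NavierStokesRegularity.Theorems.EulerZoomLiouvillePowerGaugeEulerLiouvillePressureSwap
import HarnessLib

/-!
# Crux `EulerZoomLiouville.PowerGaugeEulerLiouville` (stmt-NavierStokesRegularity-19832), line `relative_equilibria` (ns-idea-11), R3a PORT RECIPE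
# brick P4 (slaving half), file 3: ★ SPIRAL PRESSURE SLAVING — the pressure of a spiral (Perelman-ansatz) member IS spiral, with a SCALAR profile

Route №10 `EulerZoomLiouville` (NavierStokesRegularity), crux E; width seat ns-sfl-p1 g11 under the LEAD ns-typeII-p2 (R3a recipe of
`Cruxes/PowerGaugeEulerLiouville/Lines/relative-equilibria.md`, brick P4 = spiral twin of `PressureSlaving.inClass_pastSelfSimilarPressure`
(…SelfSimilarPressureSlavingPast); file 1 = `…SpiralPressureSlavingTools`, file 2 = `…SpiralPressureSlavingTop` (centred coordinates), the (D₁)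
growth half = `…SpiralPastPressureGrowth`).

SPIRAL velocity about `(T, x₀)`, skew generator `S` (`⟪Sx, y⟫ = −⟪x, Sy⟫`), rate `γ`, profile `V`, on the past window `τ < T₁` (`T₁ ≤ 0`, `T₁ ≤ T`):
`u(τ, x) = λ^{γ−1} e^{(log λ)S} V(e^{−(log λ)S} λ^{−γ}(x − x₀))`, `λ = T − τ` (the line's `IsPastSpiral ρ T T₁ x₀ S u V` at `γ = 1/(2+ρ)`, `twist`
written out as `NormedSpace.exp`).  As for the untwisted past-exact strata, the pressure clause of the spiral stratum is REDUNDANT: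

(file 2: `Spiral.ae_eq_rescaledRotatedPressure_top`, `Spiral.exists_profilePressure_top` — slaving on the centred window slab.)

* `Spiral.exists_profilePressure_pastSpiral` — **SLAVING, PAST FORM** in the original coordinates (a.e. on `ℝ³` for a.e. `τ < T₁`, and a.e. on
  `(−∞, T₁) × ℝ³`);
* ★ `Spiral.inClass_pastSpiralPressure` — **MEMBER FORM**: crux binders verbatim (`ρ > −1/2`) + the spiral velocity clause ⇒ a measurable `Q` and a
  pressure `p' = p` a.e. with `InClass ρ u p' H c` (`PressureSwap.inClass_congr_pressure_ae`) and the EXACT clause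
  `∀ τ < T₁, p' τ = fun x => (T−τ)^{2(γ−1)} Q(e^{−(log(T−τ))S} (T−τ)^{−γ}(x − x₀))` — the input of `Spiral.profile_pressure_growth_of_gaugeD_pastSpiral` (D₁).

WHAT THIS IS NOT: not NS, not E, not a stub: one brick (P4) of the port R3a of a width sub-line (spiral = `O(3)`-twisted self-similar stratum of
`stub_nonSelfSimilarRest`); a de-conditioning lemma on the MODEL lattice of the OPEN crux class 19832; no summit statement is proved by this file.
[folklore; RusinSverak2011 §2 p. 4; CaffarelliKohnNirenberg1982 §2; ChaeTsai2013DSS p. 4 (Perelman's rotated ansatz)]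
-/

noncomputable section

-- flat `Theorems/<Route><Decl>…` files of one crux share the namespace of the crux (tree convention: `Summit.<S>.<S>.…`)
set_option linter.dupNamespace false

open MeasureTheory Set Filter Topology Metric Function TopologicalSpace
open scoped ENNReal NNReal RealInnerProductSpace

namespace Summit.NavierStokesRegularity.NavierStokesRegularity.Theorems.PowerGaugeEulerLiouville

open Literature.Analysis Literature.Analysis.FunctionSpaces Literature.Analysis.FluidPDE

namespace Spiral

variable {S : EuclideanSpace ℝ (Fin 3) →L[ℝ] EuclideanSpace ℝ (Fin 3)}

/-! ### Back to the original coordinates -/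

/-- The uncurried spiral pressure ansatz `(τ, x) ↦ (T − τ)^{2(γ−1)} Q(e^{−(log(T−τ))S} (T − τ)^{−γ}(x − x₀))` is measurable for measurable `Q`.
[folklore] -/
theorem measurable_uncurry_spiralPressure {γ T : ℝ} (x₀ : EuclideanSpace ℝ (Fin 3))
    (S : EuclideanSpace ℝ (Fin 3) →L[ℝ] EuclideanSpace ℝ (Fin 3)) {Q : EuclideanSpace ℝ (Fin 3) → ℝ} (hQm : Measurable Q) :
    Measurable (uncurry fun (τ : ℝ) (x : EuclideanSpace ℝ (Fin 3)) => (T - τ) ^ (2 * (γ - 1)) *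
      Q (NormedSpace.exp ((-Real.log (T - τ)) • S) ((T - τ) ^ (-γ) • (x - x₀)))) := by
  have hc : Measurable fun t : ℝ => -Real.log (T - t) := (Real.measurable_log.comp (measurable_const.sub measurable_id)).neg
  have h1 : Measurable fun z : ℝ × EuclideanSpace ℝ (Fin 3) =>
      NormedSpace.exp ((-Real.log (T - z.1)) • S) ((T - z.1) ^ (-γ) • (z.2 - x₀)) :=
    (measurable_uncurry_expSkew_apply S hc).comp
      (measurable_fst.prodMk (((measurable_fst.const_sub T).pow_const _).smul (measurable_snd.sub_const x₀)))
  exact ((measurable_fst.const_sub T).pow_const _).mul (hQm.comp h1)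

/-- **SPIRAL PRESSURE SLAVING, PAST FORM.**  Let `(u, p)` be a distributional Euler pair (no force) on the slab `(−∞,0) × ℝ³` with the `D`-type
growth `∫∫_{Q_a(0)} |p|^{3/2} ≤ K a^m` for `a ≥ a₀` (`K < ∞`, `m < 3`), and let the velocity be SPIRAL ABOUT `(T, x₀)` ON THE PAST WINDOW
`τ < T₁` (`T₁ ≤ 0`, `T₁ ≤ T`), of any rate `γ`, skew generator `S`, profile `V`.  Then the pressure is the spiral ansatz of a measurable SCALAR
profile `Q` on that window: `p(τ, x) = (T−τ)^{2(γ−1)} Q(e^{−(log(T−τ))S} (T−τ)^{−γ}(x − x₀))` a.e. on `ℝ³` for a.e. `τ < T₁`, and a.e. on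
`(−∞, T₁) × ℝ³`. `S = 0`: `PressureSlaving.exists_profilePressure_past`. [folklore; RusinSverak2011 §2 p. 4; CaffarelliKohnNirenberg1982 §2] -/
theorem exists_profilePressure_pastSpiral {γ T T₁ : ℝ} {x₀ : EuclideanSpace ℝ (Fin 3)} (hT₁ : T₁ ≤ 0) (hT : T₁ ≤ T)
    (hS : ∀ x y : EuclideanSpace ℝ (Fin 3), ⟪S x, y⟫ = -⟪x, S y⟫)
    {u : ℝ → EuclideanSpace ℝ (Fin 3) → EuclideanSpace ℝ (Fin 3)} {p : ℝ → EuclideanSpace ℝ (Fin 3) → ℝ}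
    {V : EuclideanSpace ℝ (Fin 3) → EuclideanSpace ℝ (Fin 3)}
    (hdist : IsDistributionalNSSolutionOn (slab (EuclideanSpace ℝ (Fin 3)) (Iio 0) isOpen_Iio) 0 0 u p)
    {K : ℝ≥0∞} (hK : K ≠ ⊤) {m a₀ : ℝ} (hm : m < 3)
    (hD : ∀ a : ℝ, a₀ ≤ a →
      ∫⁻ z in parabolicCylinder a (0 : ℝ × EuclideanSpace ℝ (Fin 3)), ‖p z.1 z.2‖ₑ ^ (3 / 2 : ℝ) ≤ K * ENNReal.ofReal (a ^ m))
    (hu : ∀ τ : ℝ, τ < T₁ → u τ = fun x => (T - τ) ^ (γ - 1) •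
      NormedSpace.exp ((Real.log (T - τ)) • S) (V (NormedSpace.exp ((-Real.log (T - τ)) • S) ((T - τ) ^ (-γ) • (x - x₀))))) :
    ∃ Q : EuclideanSpace ℝ (Fin 3) → ℝ, Measurable Q ∧
      (∀ᵐ τ ∂(volume.restrict (Iio T₁)),
        p τ =ᵐ[volume] fun x => (T - τ) ^ (2 * (γ - 1)) *
          Q (NormedSpace.exp ((-Real.log (T - τ)) • S) ((T - τ) ^ (-γ) • (x - x₀)))) ∧
      ∀ᵐ z ∂(volume.restrict (Iio T₁ ×ˢ (univ : Set (EuclideanSpace ℝ (Fin 3))))),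
        p z.1 z.2 = (T - z.1) ^ (2 * (γ - 1)) *
          Q (NormedSpace.exp ((-Real.log (T - z.1)) • S) ((T - z.1) ^ (-γ) • (z.2 - x₀))) := by
  -- adapted from `PressureSlaving.exists_profilePressure_past` (…SelfSimilarPressureSlavingPast)
  set S₁ : ℝ := T₁ - T with hS₁
  have hS' : S₁ ≤ 0 := by rw [hS₁]; linarith
  have hST : S₁ ≤ -T := by rw [hS₁]; linarith
  set w : ℝ → EuclideanSpace ℝ (Fin 3) → EuclideanSpace ℝ (Fin 3) := stPull 1 1 T x₀ u with hwdef
  set q : ℝ → EuclideanSpace ℝ (Fin 3) → ℝ := stPull 1 1 T x₀ p with hqdef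
  have hdist' : IsDistributionalNSSolutionOn (slab (EuclideanSpace ℝ (Fin 3)) (Iio S₁) isOpen_Iio) 0 0 w q :=
    PressureSlaving.isDistributional_shift hST x₀ hdist
  have hw : ∀ s : ℝ, s < S₁ → w s = fun y => (-s) ^ (γ - 1) •
      NormedSpace.exp ((Real.log (-s)) • S) (V (NormedSpace.exp ((-Real.log (-s)) • S) ((-s) ^ (-γ) • y))) :=
    shift_spiral hu
  -- the growth of `q` on the cylinders hanging from the window top
  set L₀ : ℝ := ‖x₀‖ + |T₁| + 2 with hL₀
  have hL₀1 : 1 ≤ L₀ := by rw [hL₀]; linarith [norm_nonneg x₀, abs_nonneg T₁]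
  have hD' : ∀ a : ℝ, max a₀ 1 ≤ a →
      ∫⁻ z in parabolicCylinder a (S₁, (0 : EuclideanSpace ℝ (Fin 3))), ‖q z.1 z.2‖ₑ ^ (3 / 2 : ℝ) ≤
        (K * ENNReal.ofReal (L₀ ^ m)) * ENNReal.ofReal (a ^ m) := by
    intro a ha
    have ha₀ : a₀ ≤ a := (le_max_left _ _).trans ha
    have ha1 : 1 ≤ a := (le_max_right _ _).trans ha
    have ha0 : 0 < a := one_pos.trans_le ha1
    have e1 : q = (1 : ℝ) • stPull 1 1 T x₀ p := by rw [hqdef, one_smul]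
    calc ∫⁻ z in parabolicCylinder a (S₁, (0 : EuclideanSpace ℝ (Fin 3))), ‖q z.1 z.2‖ₑ ^ (3 / 2 : ℝ)
        ≤ ∫⁻ z in stAffine 1 1 T x₀ ⁻¹' parabolicCylinder a (T₁, x₀), ‖q z.1 z.2‖ₑ ^ (3 / 2 : ℝ) :=
          lintegral_mono_set (PressureSlaving.parabolicCylinder_subset_preimage_shift T T₁ x₀ a)
      _ = ∫⁻ z in parabolicCylinder a (T₁, x₀), ‖p z.1 z.2‖ₑ ^ (3 / 2 : ℝ) := by
          rw [e1, setLIntegral_enorm_rpow_stRescale one_pos one_pos T x₀ _ p _ (by norm_num)]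
          simp
      _ ≤ ∫⁻ z in parabolicCylinder (L₀ * a) (0 : ℝ × EuclideanSpace ℝ (Fin 3)), ‖p z.1 z.2‖ₑ ^ (3 / 2 : ℝ) :=
          lintegral_mono_set (PressureSlaving.parabolicCylinder_shift_subset hT₁ x₀ ha1)
      _ ≤ K * ENNReal.ofReal ((L₀ * a) ^ m) := hD _ (ha₀.trans (by nlinarith))
      _ = (K * ENNReal.ofReal (L₀ ^ m)) * ENNReal.ofReal (a ^ m) := by
          rw [Real.mul_rpow (by linarith) ha0.le, ENNReal.ofReal_mul (Real.rpow_nonneg (by linarith) _), mul_assoc]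
  obtain ⟨Q, hQm, hQ⟩ := exists_profilePressure_top hS' hS hdist' (ENNReal.mul_ne_top hK ENNReal.ofReal_ne_top) hm hD' hw
  -- un-shift: space
  have hQ' : ∀ᵐ s ∂(volume.restrict (Iio S₁)),
      p (T + s) =ᵐ[volume] fun x => (-s) ^ (2 * (γ - 1)) *
        Q (NormedSpace.exp ((-Real.log (-s)) • S) ((-s) ^ (-γ) • (x - x₀))) := by
    filter_upwards [hQ] with s hs
    have h1 := ((measurePreserving_sub_right (volume : Measure (EuclideanSpace ℝ (Fin 3))) x₀).quasiMeasurePreserving).ae hs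
    filter_upwards [h1] with x hx
    rw [hqdef, stPull_apply, one_mul, one_smul, add_sub_cancel] at hx
    exact hx
  -- un-shift: time
  have hslice : ∀ᵐ τ ∂(volume.restrict (Iio T₁)),
      p τ =ᵐ[volume] fun x => (T - τ) ^ (2 * (γ - 1)) *
        Q (NormedSpace.exp ((-Real.log (T - τ)) • S) ((T - τ) ^ (-γ) • (x - x₀))) := by
    have h1 : ∀ᵐ s ∂(volume : Measure ℝ), s ∈ Iio S₁ →
        p (T + s) =ᵐ[volume] fun x => (-s) ^ (2 * (γ - 1)) *
          Q (NormedSpace.exp ((-Real.log (-s)) • S) ((-s) ^ (-γ) • (x - x₀))) :=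
      (ae_restrict_iff' measurableSet_Iio).1 hQ'
    have h2 := ((measurePreserving_sub_right (volume : Measure ℝ) T).quasiMeasurePreserving).ae h1
    refine (ae_restrict_iff' measurableSet_Iio).2 ?_
    filter_upwards [h2] with τ hτ hτT
    have hmem : τ - T ∈ Iio S₁ := by rw [mem_Iio, hS₁]; exact sub_lt_sub_right hτT T
    have := hτ hmem
    rwa [add_sub_cancel, show -(τ - T) = T - τ by ring] at this
  refine ⟨Q, hQm, hslice, ?_⟩
  -- product form on `(−∞, T₁) × ℝ³`
  have hpm : AEStronglyMeasurable (uncurry p) (volume.restrict (Iio T₁ ×ˢ (univ : Set (EuclideanSpace ℝ (Fin 3))))) := by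
    have h := hdist.2.2.1
    rw [coe_slab] at h
    exact (h.mono_set (prod_mono (Iio_subset_Iio hT₁) le_rfl)).aestronglyMeasurable
  have hPm : AEStronglyMeasurable (uncurry fun τ x => (T - τ) ^ (2 * (γ - 1)) *
      Q (NormedSpace.exp ((-Real.log (T - τ)) • S) ((T - τ) ^ (-γ) • (x - x₀))))
      (volume.restrict (Iio T₁ ×ˢ (univ : Set (EuclideanSpace ℝ (Fin 3))))) :=
    (measurable_uncurry_spiralPressure x₀ S hQm).aestronglyMeasurable
  -- slices to slab at top `T₁`
  rw [PressureSlaving.volume_restrict_slab_eq_prod_top] at hpm hPm ⊢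
  have hSm : MeasurableSet {z : ℝ × EuclideanSpace ℝ (Fin 3) |
      hpm.mk (uncurry p) z = hPm.mk (uncurry fun τ x => (T - τ) ^ (2 * (γ - 1)) *
        Q (NormedSpace.exp ((-Real.log (T - τ)) • S) ((T - τ) ^ (-γ) • (x - x₀)))) z} :=
    hpm.stronglyMeasurable_mk.measurableSet_eq_fun hPm.stronglyMeasurable_mk
  have h1 := Measure.ae_ae_of_ae_prod hpm.ae_eq_mk
  have h2 := Measure.ae_ae_of_ae_prod hPm.ae_eq_mk
  have h3 : ∀ᵐ τ ∂((volume : Measure ℝ).restrict (Iio T₁)), ∀ᵐ x ∂(volume : Measure (EuclideanSpace ℝ (Fin 3))),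
      (τ, x) ∈ {z : ℝ × EuclideanSpace ℝ (Fin 3) |
        hpm.mk (uncurry p) z = hPm.mk (uncurry fun τ x => (T - τ) ^ (2 * (γ - 1)) *
          Q (NormedSpace.exp ((-Real.log (T - τ)) • S) ((T - τ) ^ (-γ) • (x - x₀)))) z} := by
    filter_upwards [hslice, h1, h2] with τ hτ h1τ h2τ
    filter_upwards [hτ, h1τ, h2τ] with x hx h1x h2x
    show hpm.mk (uncurry p) (τ, x) = hPm.mk (uncurry fun τ x => (T - τ) ^ (2 * (γ - 1)) *
      Q (NormedSpace.exp ((-Real.log (T - τ)) • S) ((T - τ) ^ (-γ) • (x - x₀)))) (τ, x)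
    rw [← h1x, ← h2x]
    exact hx
  have h4 := (Measure.ae_prod_mem_iff_ae_ae_mem hSm).2 h3
  filter_upwards [hpm.ae_eq_mk, hPm.ae_eq_mk, h4] with z hz1 hz2 hz
  have e : uncurry p z = (uncurry fun τ x => (T - τ) ^ (2 * (γ - 1)) *
      Q (NormedSpace.exp ((-Real.log (T - τ)) • S) ((T - τ) ^ (-γ) • (x - x₀)))) z := by rw [hz1, hz2]; exact hz
  simpa only [uncurry] using e

/-! ### The member form -/

/-- ★ **MEMBER FORM, SPIRAL STRATUM.**  Crux binders verbatim (`InClass ρ u p H c` unfolded; any `ρ > −1/2`) + the velocity is SPIRAL ABOUT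
`(T, x₀)` ON THE PAST WINDOW `τ < T₁` (`T₁ ≤ 0`, `T₁ ≤ T`), of any rate `γ`, with skew generator `S` and profile `V` (the line's
`IsPastSpiral ρ T T₁ x₀ S u V` is `γ = 1/(2+ρ)`) ⇒ there are a measurable SCALAR pressure profile `Q` and a pressure `p'` with: `p' = p` a.e. on
the slab, `(u, p', H)` satisfies the three crux hypotheses with the SAME `c` (`PressureSwap.inClass_congr_pressure_ae`), and the EXACT spiral
pressure clause `∀ τ < T₁, p' τ = fun x => (T−τ)^{2(γ−1)} Q(e^{−(log(T−τ))S} (T−τ)^{−γ}(x − x₀))` (`p' τ x := if τ < T₁ then … else p τ x`).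
So the spiral stratum needs no pressure clause: the pressure of a spiral member IS spiral, with a scalar profile rotating with the velocity.
`S = 0`: `PressureSlaving.inClass_pastSelfSimilarPressure`. [folklore; RusinSverak2011 §2 p. 4; CaffarelliKohnNirenberg1982 §2; ChaeTsai2013DSS p. 4] -/
theorem inClass_pastSpiralPressure {ρ γ T T₁ : ℝ} {x₀ : EuclideanSpace ℝ (Fin 3)} (hρ : -1 / 2 < ρ) (hT₁ : T₁ ≤ 0) (hT : T₁ ≤ T)
    (hS : ∀ x y : EuclideanSpace ℝ (Fin 3), ⟪S x, y⟫ = -⟪x, S y⟫)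
    {u : ℝ → EuclideanSpace ℝ (Fin 3) → EuclideanSpace ℝ (Fin 3)} {p : ℝ → EuclideanSpace ℝ (Fin 3) → ℝ}
    {H : ℝ → EuclideanSpace ℝ (Fin 3) → EuclideanSpace ℝ (Fin 3) →L[ℝ] EuclideanSpace ℝ (Fin 3)} {c : ℝ≥0}
    {V : EuclideanSpace ℝ (Fin 3) → EuclideanSpace ℝ (Fin 3)}
    (hcls : IsSuitableWeakSolutionOn (slab (EuclideanSpace ℝ (Fin 3)) (Iio 0) isOpen_Iio) 0 0 u p ∧
      HasWeakSpatialGradientOn (slab (EuclideanSpace ℝ (Fin 3)) (Iio 0) isOpen_Iio) u H ∧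
      (∀ a : ℝ, 0 < a →
        ENNReal.ofReal (a ^ (2 * ρ)) * cknA a (0 : ℝ × EuclideanSpace ℝ (Fin 3)) u +
              ENNReal.ofReal (a ^ ρ) * cknE a (0 : ℝ × EuclideanSpace ℝ (Fin 3)) H +
            ENNReal.ofReal (a ^ (2 * ρ)) * cknD a (0 : ℝ × EuclideanSpace ℝ (Fin 3)) p ≤ (c : ℝ≥0∞)))
    (hu : ∀ τ : ℝ, τ < T₁ → u τ = fun x => (T - τ) ^ (γ - 1) •
      NormedSpace.exp ((Real.log (T - τ)) • S) (V (NormedSpace.exp ((-Real.log (T - τ)) • S) ((T - τ) ^ (-γ) • (x - x₀))))) :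
    ∃ (Q : EuclideanSpace ℝ (Fin 3) → ℝ) (p' : ℝ → EuclideanSpace ℝ (Fin 3) → ℝ), Measurable Q ∧
      (∀ τ : ℝ, τ < T₁ → p' τ = fun x => (T - τ) ^ (2 * (γ - 1)) *
        Q (NormedSpace.exp ((-Real.log (T - τ)) • S) ((T - τ) ^ (-γ) • (x - x₀)))) ∧
      (uncurry p' =ᵐ[volume.restrict (Iio (0 : ℝ) ×ˢ (univ : Set (EuclideanSpace ℝ (Fin 3))))] uncurry p) ∧
      (IsSuitableWeakSolutionOn (slab (EuclideanSpace ℝ (Fin 3)) (Iio 0) isOpen_Iio) 0 0 u p' ∧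
        HasWeakSpatialGradientOn (slab (EuclideanSpace ℝ (Fin 3)) (Iio 0) isOpen_Iio) u H ∧
        (∀ a : ℝ, 0 < a →
          ENNReal.ofReal (a ^ (2 * ρ)) * cknA a (0 : ℝ × EuclideanSpace ℝ (Fin 3)) u +
                ENNReal.ofReal (a ^ ρ) * cknE a (0 : ℝ × EuclideanSpace ℝ (Fin 3)) H +
              ENNReal.ofReal (a ^ (2 * ρ)) * cknD a (0 : ℝ × EuclideanSpace ℝ (Fin 3)) p' ≤ (c : ℝ≥0∞))) := by
  -- adapted from `PressureSlaving.inClass_pastSelfSimilarPressure` (…SelfSimilarPressureSlavingPast)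
  obtain ⟨hsw, hH, hc⟩ := hcls
  have hcD : ∀ a : ℝ, 0 < a →
      ENNReal.ofReal (a ^ (2 * ρ)) * cknD a (0 : ℝ × EuclideanSpace ℝ (Fin 3)) p ≤ (c : ℝ≥0∞) :=
    fun a ha => le_trans le_add_self (hc a ha)
  have hD : ∀ a : ℝ, 1 ≤ a →
      ∫⁻ z in parabolicCylinder a (0 : ℝ × EuclideanSpace ℝ (Fin 3)), ‖p z.1 z.2‖ₑ ^ (3 / 2 : ℝ) ≤
        (c : ℝ≥0∞) * ENNReal.ofReal (a ^ (2 - 2 * ρ)) :=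
    fun a ha => PressureSlaving.lintegral_cylinder_le_of_gaugeD hcD (one_pos.trans_le ha)
  obtain ⟨Q, hQm, -, hQ⟩ := exists_profilePressure_pastSpiral hT₁ hT hS hsw.distributional ENNReal.coe_ne_top (m := 2 - 2 * ρ)
    (by linarith) hD hu
  set p' : ℝ → EuclideanSpace ℝ (Fin 3) → ℝ := fun τ x =>
    if τ < T₁ then (T - τ) ^ (2 * (γ - 1)) * Q (NormedSpace.exp ((-Real.log (T - τ)) • S) ((T - τ) ^ (-γ) • (x - x₀)))
    else p τ x with hp'
  have hpp : uncurry p' =ᵐ[volume.restrict (Iio (0 : ℝ) ×ˢ (univ : Set (EuclideanSpace ℝ (Fin 3))))] uncurry p := by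
    have h1 : ∀ᵐ z ∂(volume : Measure (ℝ × EuclideanSpace ℝ (Fin 3))),
        z ∈ Iio T₁ ×ˢ (univ : Set (EuclideanSpace ℝ (Fin 3))) → p z.1 z.2 = (T - z.1) ^ (2 * (γ - 1)) *
          Q (NormedSpace.exp ((-Real.log (T - z.1)) • S) ((T - z.1) ^ (-γ) • (z.2 - x₀))) :=
      (ae_restrict_iff' (measurableSet_Iio.prod MeasurableSet.univ)).1 hQ
    filter_upwards [ae_restrict_of_ae (μ := (volume : Measure (ℝ × EuclideanSpace ℝ (Fin 3))))
      (s := Iio (0 : ℝ) ×ˢ (univ : Set (EuclideanSpace ℝ (Fin 3)))) h1] with z hz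
    show p' z.1 z.2 = p z.1 z.2
    simp only [hp']
    split_ifs with hlt
    · exact (hz (mem_prod.2 ⟨hlt, mem_univ _⟩)).symm
    · rfl
  refine ⟨Q, p', hQm, fun τ hτ => ?_, hpp, PressureSwap.inClass_congr_pressure_ae ⟨hsw, hH, hc⟩ hpp⟩
  funext x
  simp only [hp', if_pos hτ]

end Spiral

end Summit.NavierStokesRegularity.NavierStokesRegularity.Theorems.PowerGaugeEulerLiouville

end
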